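import Literature.AlgebraicGeometry.Resolution.AlterationsInduction
import Literature.AlgebraicGeometry.Resolution.AlterationsResolution
import HarnessLib

/-!
# Modifications in de Jong's proof of Thm. 4.1: a regular projective modification with strict
normal crossings boundary solves the problem (de Jong 1996, 2.17, 2.20, 4.4, 4.28)

Topic: `Literature/AlgebraicGeometry/Resolution`. Proved bookkeeping shared by the decomposition
of de Jong 1996, Thm. 4.1 (`AlterationsStrong.lean`, `AlterationsInduction.lean`,
`AlterationsSemiStable.lean` and its companions). Several steps of the printed proof replace the
pair `(X, Z)` along a MODIFICATION (2.17: a proper birational morphism from an integral scheme)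
— the blow-up of Lemma 4.11, the extended `β : 𝒞 → X` of 4.21–4.22, the modification of
Lemma 3.2 in 4.24, the blow-ups of 4.26–4.28 — and the proof ends (4.28) when a modification
`φ₁ : X₁ → X` has been found with `X₁` nonsingular projective and `φ₁⁻¹(Z)` a strict normal
crossings divisor: then `(X₁, X̄₁ = X₁, φ₁, j₁ = 𝟙)` solves the problem of Thm. 4.1, and `φ₁` is
generically étale. This file proves exactly that:

* `IsBirational.isGenericallyEtale` — a birational morphism (`IsBirational`: an isomorphism over
  a dense open with dense preimage) is generically étale (2.6, `IsGenericallyEtale`);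
* `IsBirational.isAlteration` — a proper birational morphism from a reduced scheme onto an
  integral scheme is an alteration (2.20, `IsAlteration`; "a modification is an alteration");
* `DeJong1996.ConclusionGenericallyEtale.of_isBirational` (and the version without the clause,
  `DeJong1996.Conclusion.of_isBirational`) — the exit of the printed proof in 4.28: a proper
  birational `φ₁ : X₁ → X` with `X₁` regular, projective over `k`, and `φ₁⁻¹(Z)` a strict normal
  crossings divisor gives `DeJong1996.ConclusionGenericallyEtale f Z` with `X̄₁ = X₁`, `j₁ = 𝟙`.

## Sources

* A. J. de Jong, *Smoothness, semi-stability and alterations*, Publ. Math. IHÉS 83 (1996) 51–93: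
  2.6, 2.17, 2.20 (pp. 55, 59–61), Thm. 4.1 and 4.4 (p. 66), 4.28 (p. 76).
-/

noncomputable section

open CategoryTheory AlgebraicGeometry TopologicalSpace Topology

namespace Literature.AlgebraicGeometry.Resolution

universe u

/-! ## Modifications are generically étale alterations -/

/-- A birational morphism is generically étale: it is an isomorphism over a dense open of the
target whose preimage is dense (de Jong 1996, 2.6 with 2.17). [folklore] -/
theorem IsBirational.isGenericallyEtale {X' X : Scheme.{u}} {π : X' ⟶ X} (hπ : IsBirational π) :
    IsGenericallyEtale π := by
  obtain ⟨U, -, hU', hiso⟩ := hπ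
  exact IsGenericallyEtale.of_isIso_morphismRestrict π U hU'

/-- **A modification is an alteration** (de Jong 1996, 2.17 and 2.20): a proper birational
morphism `π : X' → X` from a reduced scheme onto an integral scheme is an alteration — `X'` is
integral (`IsBirational.isIntegral`), `π` is dominant (`IsBirational.isDominant`) and it is an
isomorphism, in particular finite, over a non-empty open. [cite: DeJong1996, 2.20, p. 61] -/
theorem IsBirational.isAlteration {X' X : Scheme.{u}} {π : X' ⟶ X} [IsIntegral X] [IsReduced X']
    [IsProper π] (hπ : IsBirational π) : IsAlteration π := by
  haveI : IsIntegral X' := hπ.isIntegral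
  haveI : IsDominant π := hπ.isDominant
  obtain ⟨U, hU, -, hiso⟩ := hπ
  exact ⟨inferInstance, inferInstance, inferInstance, U, hU.nonempty, inferInstance⟩

/-! ## The exit of the proof of Thm. 4.1 (4.28) -/

namespace DeJong1996

variable {k : Type u} [Field k] {X X₁ : Scheme.{u}} {f : X ⟶ Spec (.of k)} {Z : Set X}
  {φ₁ : X₁ ⟶ X}

/-- The boundary of Thm. 4.1 for the compactification `j₁ = 𝟙`: `𝟙(φ₁⁻¹(Z)) ∪ (X₁ ∖ 𝟙(X₁))`
is just `φ₁⁻¹(Z)`. [folklore] -/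
theorem image_id_union_compl_range_id (S : Set X₁) :
    (𝟙 X₁ : X₁ ⟶ X₁) '' S ∪ (Set.range (𝟙 X₁ : X₁ ⟶ X₁))ᶜ = S := by
  have hid : ((𝟙 X₁ : X₁ ⟶ X₁) : X₁ → X₁) = id := by
    funext x
    simp
  rw [hid, Set.image_id, Set.range_id, Set.compl_univ, Set.union_empty]

/-- **The exit of de Jong's proof (4.28): a regular projective modification with strict normal
crossings boundary solves Thm. 4.1, generically étale.** If `X` is a variety over `k`,
`φ₁ : X₁ → X` is proper and birational (a modification; e.g. a composition of blow-ups), `X₁` is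
regular and projective over `k`, and `φ₁⁻¹(Z)` is a strict normal crossings divisor in `X₁`, then
`(X₁, X̄₁ = X₁, φ₁, j₁ = 𝟙)` is a solution of the problem posed in Thm. 4.1 for `(X, Z)`, with
`φ₁` generically étale ("4.28. By repeatedly blowing up `(X, Z)` … we finally get the situation
that `X` is nonsingular and `Z` is a … strict normal crossings [divisor]. This finishes the
proof of Theorem 4.1."). [cite: DeJong1996, 4.28, p. 76] -/
theorem ConclusionGenericallyEtale.of_isBirational [IsIntegral X] [IsProper φ₁]
    (hφ : IsBirational φ₁) (hreg : Scheme.IsRegular X₁)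
    (hproj : Literature.AlgebraicGeometry.Motives.IsProjectiveOver (Over.mk (φ₁ ≫ f)))
    (hsnc : IsStrictNormalCrossingsDivisor X₁ (φ₁ ⁻¹' Z)) : ConclusionGenericallyEtale f Z := by
  haveI : IsReduced X₁ := hreg.isReduced
  haveI : IsIntegral X₁ := hφ.isIntegral
  refine ⟨X₁, X₁, φ₁, 𝟙 X₁, φ₁ ≫ f, hφ.isAlteration, inferInstance, inferInstance, hproj, hreg,
    Category.id_comp _, ?_, hφ.isGenericallyEtale⟩
  rwa [image_id_union_compl_range_id]

/-- The same exit for Thm. 4.1 without the generically-étale clause.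
[cite: DeJong1996, 4.28, p. 76] -/
theorem Conclusion.of_isBirational [IsIntegral X] [IsProper φ₁] (hφ : IsBirational φ₁)
    (hreg : Scheme.IsRegular X₁)
    (hproj : Literature.AlgebraicGeometry.Motives.IsProjectiveOver (Over.mk (φ₁ ≫ f)))
    (hsnc : IsStrictNormalCrossingsDivisor X₁ (φ₁ ⁻¹' Z)) : Conclusion f Z :=
  (ConclusionGenericallyEtale.of_isBirational hφ hreg hproj hsnc).conclusion

/-- **Replacing `(X, Z)` along a modification** (de Jong 1996, 4.4 for modifications, as used in
4.12, 4.22, 4.24): if `φ : X' → X` is proper and birational with `X'` reduced and `X` a variety,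
a generically étale solution for `(X', φ⁻¹(Z))` gives one for `(X, Z)`.
[cite: DeJong1996, 4.4, p. 66] -/
theorem ConclusionGenericallyEtale.of_isBirational_of_conclusion {X' : Scheme.{u}} [IsIntegral X]
    {φ : X' ⟶ X} [IsReduced X'] [IsProper φ] (hφ : IsBirational φ)
    (h : ConclusionGenericallyEtale (φ ≫ f) (φ ⁻¹' Z)) : ConclusionGenericallyEtale f Z :=
  ConclusionGenericallyEtale.of_isAlteration hφ.isAlteration hφ.isGenericallyEtale h

end DeJong1996

end Literature.AlgebraicGeometry.Resolution

end
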